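import Summits.KontsevichZagierPeriods.KontsevichZagierPeriods.Theorems.KzOnePeriodsE1DerivCMRows

/-!
# E1 derivations, part 10: rows with coefficients in `ℚ(ρ) = ℚ(√−3)` — the unit `ρ = e^{2πi/3}`

Sub-problem `KzOnePeriods` (the theorem of Huber–Wüstholz [cite: HuberWustholz2022, Thm 13.3 (2)
p.121]); helper lane of the `E1` derivation modules; the `ℚ(ρ)`-twin of §6 of part 9
(`KzOnePeriodsE1DerivCMRows`, `K = ℚ(i)`): the engine is part 8 (`KzOnePeriodsE1DerivCMEngine`),
the general unit rows part 9 (`span_unit_rows_omega`, `span_unit_rows_eta`), the unit lemmas part 7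
(`KzOnePeriodsE1DerivCMUnits`).

For a curve `y² = x³ + b` (`g₂ = 0`, `j = 0`) the period lattice has the unit `ρ`
(`unit_ρ_of_g₂_eq_zero`, from `ρ_mul_mem_lattice_iff_of_j_eq_zero`); `[ρ]` acts on points by
`φ(ρu) = (ρx, y)` (`phi_ρ_mul`), on `ζ` by `ζ(ρz) = ρ²ζ(z)` (`weierstrassZeta_ρ_mul`, `ρ⁻¹ = ρ²`), and
`η(ρℓ) = ρ²η(ℓ)` (`zeta_add_ρ_period`).  Coefficients are written `x + yρ` (`x, y ∈ ℚ`, basis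
`1, ρ` of `ℚ(ρ)`, `ρ² = −1 − ρ`): `span_eisen_rows_omega` / `span_eisen_rows_eta` are
`span_unit_rows_omega` / `span_unit_rows_eta` with `α = ρ`, `β = ρ⁻¹ = ρ²`, the products
`(x + yρ)ρ = −y + (x − y)ρ`, `(x + yρ)ρ² = (y − x) − xρ` split into the two exact `ℚ`-identities
(`eisen_coef_split`, `eisen_coef_split'`) that generated case files check by `norm_num`;
`eisen_rows_numbers` is the matching bookkeeping of the η-row numbers (`unit_rows_numbers`,
`γ = ρ²`); `zeta_base_point_ρ` is the base-point dictionary at an image point `[ρ]P`.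
[cite: HuberWustholz2022, §13.1 (A)–(B) p.120, Thm 13.3 (2) p.121, §18.1 pp.160–161;
Cox2013, §10.B Thm. 10.14; ArmitageEberlein2001, §7.4.2 (7.66)]

No new axioms; no statements of the programme are cited.
-/

noncomputable section

open MvPolynomial Set Complex
open Literature.NumberTheory.Transcendental Literature.NumberTheory.Transcendental.CurvePeriods
open Literature.NumberTheory.Transcendental.CurvePeriods.Ell
open scoped PeriodPair

namespace Summit.KontsevichZagierPeriods.KzOnePeriods.E1LiftDerivation

/-- `c` lies in the `ℚ̄`-span of the elementary relations (R1)–(R5). -/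
local notation3 "InSpanRel " c:arg => ∃ (k : ℕ) (ρ : Fin k → (PeriodSymbol →₀ ℂ))
  (a : Fin k → ℂ), (∀ l, IsElementaryRelation (ρ l)) ∧ (∀ l, IsAlgebraic ℚ (a l)) ∧
    c = ∑ l, a l • ρ l

variable {L : PeriodPair} (h₂ : IsAlgebraic ℚ L.g₂) (h₃ : IsAlgebraic ℚ L.g₃)

local notation3 (prettyPrint := false) "Sω[" D "]" =>
  LiftData.sym h₂ h₃ D ((1 / 2 : ℂ) • theta0 L) (hasAlgCoeffs_half_theta0 h₂ h₃)
local notation3 (prettyPrint := false) "Sη[" D "]" =>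
  LiftData.sym h₂ h₃ D ((1 / 2 : ℂ) • theta1 L) (hasAlgCoeffs_half_theta1 h₂ h₃)
local notation3 "𝟙" => (Finsupp.single PeriodSymbol.unit (1 : ℂ) : PeriodSymbol →₀ ℂ)
/-- `ρ = e^{2πi/3} = (−1 + √−3)/2` (Mathlib's `UpperHalfPlane.ρ`) as a complex number. -/
local notation3 "ϱ" => ((UpperHalfPlane.ρ : UpperHalfPlane) : ℂ)

/-! ## 7. `K = ℚ(ρ)`: the unit `ρ` (curves with `ρΛ = Λ`, e.g. `g₂ = 0`) -/

/-- `ρ² = −1 − ρ`. [folklore] -/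
theorem ρ_sq' : ϱ ^ 2 = -1 - ϱ := by linear_combination UpperHalfPlane.ρ_sq

/-- `(ρ²)⁻¹ = ρ` (`ρ³ = 1`). [folklore] -/
theorem ρ_sq_inv : (ϱ ^ 2)⁻¹ = ϱ :=
  inv_eq_of_mul_eq_one_right (by linear_combination PeriodPair.ρ_cube)

/-- For `g₂ = 0` (`j = 0`) the period lattice has the unit `ρ`.
[cite: Cox2013, §10.B Thm. 10.14, Thm 10.9] -/
theorem unit_ρ_of_g₂_eq_zero (h : L.g₂ = 0) : ∀ x, ϱ * x ∈ L.lattice ↔ x ∈ L.lattice :=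
  ρ_mul_mem_lattice_iff_of_j_eq_zero L (j_eq_zero_of_g₂_eq_zero L h)

/-- `ρ` is algebraic (`ρ³ = 1`). [folklore] -/
theorem isAlgebraic_ρ : IsAlgebraic ℚ ϱ :=
  IsAlgebraic.of_pow (by norm_num : 0 < 3) (by rw [PeriodPair.ρ_cube]; exact isAlgebraic_one)

/-- Elements of `ℚ(ρ)` are algebraic: the form in which the generated files state coefficients. -/
theorem isAlgebraic_of_eq_eisen {z : ℂ} (p q : ℚ) (h : z = (p : ℂ) + (q : ℂ) * ϱ) :
    IsAlgebraic ℚ z := by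
  rw [h]
  exact (isAlgebraic_algebraMap p).add ((isAlgebraic_algebraMap q).mul isAlgebraic_ρ)

/-- `x + yρ` is algebraic for `x, y ∈ ℚ`. [folklore] -/
theorem isAlgebraic_eisen (x y : ℚ) : IsAlgebraic ℚ ((x : ℂ) + (y : ℂ) * ϱ) :=
  isAlgebraic_of_eq_eisen x y rfl

section UnitRho

/-- `φ(ρu) = (ρx, y)` if `φ(u) = (x, y)` (`ρ⁻² = ρ`, `ρ⁻³ = 1`).
[cite: Cox2013, §10.B; SilvermanAEC2009, III.10] -/
theorem phi_ρ_mul (hU : ∀ x, ϱ * x ∈ L.lattice ↔ x ∈ L.lattice) {u x y : ℂ}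
    (h : phi L u = ![x, y]) : phi L (ϱ * u) = ![ϱ * x, y] := by
  rw [phi_unit_mul PeriodPair.ρ_ne_zero hU h, PeriodPair.ρ_cube, inv_one, one_mul, ρ_sq_inv]

/-- `ζ(ρz) = ρ² ζ(z)`. [folklore] -/
theorem weierstrassZeta_ρ_mul (hU : ∀ x, ϱ * x ∈ L.lattice ↔ x ∈ L.lattice) (z : ℂ) :
    L.weierstrassZeta (ϱ * z) = ϱ ^ 2 * L.weierstrassZeta z := by
  rw [weierstrassZeta_mul_of_mul_mem_lattice_iff L PeriodPair.ρ_ne_zero hU, ρ_inv]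

/-- `ζ(z + ρℓ) = ζ(z) + ρ²E` if `ζ(z + ℓ) = ζ(z) + E`. [folklore] -/
theorem zeta_add_ρ_period (hU : ∀ x, ϱ * x ∈ L.lattice ↔ x ∈ L.lattice) {ℓ E : ℂ}
    (hE : ∀ z, L.weierstrassZeta (z + ℓ) = L.weierstrassZeta z + E)
    (z : ℂ) : L.weierstrassZeta (z + ϱ * ℓ) = L.weierstrassZeta z + ϱ ^ 2 * E := by
  rw [zeta_add_unit_period PeriodPair.ρ_ne_zero hU hE, ρ_inv]

end UnitRho

/-! ## 8. `K = ℚ(ρ)`: coefficient vectors `x + yρ` (`α = ρ`, `β = ρ⁻¹ = ρ²`) -/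

/-- Splitting of `Σ_a ((x_a + y_a ρ) u_a + (x_a + y_a ρ)ρ v_a)` along the basis `1, ρ`
(`(x + yρ)ρ = −y + (x − y)ρ`). [folklore] -/
theorem eisen_coef_split {R T : ℕ} (x y : Fin R → ℚ) (u v : Fin R → ℤ) (lre lim : Fin T → ℚ)
    (w : Fin T → ℤ) (hre : ∑ a, (x a * u a - y a * v a) = ∑ t, lre t * w t)
    (him : ∑ a, (y a * u a + (x a - y a) * v a) = ∑ t, lim t * w t) :
    ∑ a, (((x a : ℂ) + (y a : ℂ) * ϱ) * (u a : ℂ) +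
        (-(y a : ℂ) + ((x a : ℂ) - (y a : ℂ)) * ϱ) * (v a : ℂ)) =
      ∑ t, ((lre t : ℂ) + (lim t : ℂ) * ϱ) * (w t : ℂ) := by
  have e1 := congrArg (fun q : ℚ => (q : ℂ)) hre
  have e2 := congrArg (fun q : ℚ => (q : ℂ)) him
  push_cast at e1 e2
  have eL : ∑ a, (((x a : ℂ) + (y a : ℂ) * ϱ) * (u a : ℂ) +
      (-(y a : ℂ) + ((x a : ℂ) - (y a : ℂ)) * ϱ) * (v a : ℂ)) =
      ∑ a, ((x a : ℂ) * (u a : ℂ) - (y a : ℂ) * (v a : ℂ)) +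
        ϱ * ∑ a, ((y a : ℂ) * (u a : ℂ) + ((x a : ℂ) - (y a : ℂ)) * (v a : ℂ)) := by
    rw [Finset.mul_sum, ← Finset.sum_add_distrib]
    exact Finset.sum_congr rfl fun a _ => by ring
  have eR : ∑ t, ((lre t : ℂ) + (lim t : ℂ) * ϱ) * (w t : ℂ) =
      ∑ t, (lre t : ℂ) * (w t : ℂ) + ϱ * ∑ t, (lim t : ℂ) * (w t : ℂ) := by
    rw [Finset.mul_sum, ← Finset.sum_add_distrib]
    exact Finset.sum_congr rfl fun t _ => by ring
  rw [eL, eR]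
  linear_combination e1 + ϱ * e2

/-- Splitting of `Σ_a ((x_a + y_a ρ) u_a + (x_a + y_a ρ)ρ² v_a)` along the basis `1, ρ`
(`(x + yρ)ρ² = (y − x) − xρ`). [folklore] -/
theorem eisen_coef_split' {R T : ℕ} (x y : Fin R → ℚ) (u v : Fin R → ℤ) (lre lim : Fin T → ℚ)
    (w : Fin T → ℤ) (hre : ∑ a, (x a * u a + (y a - x a) * v a) = ∑ t, lre t * w t)
    (him : ∑ a, (y a * u a - x a * v a) = ∑ t, lim t * w t) :
    ∑ a, (((x a : ℂ) + (y a : ℂ) * ϱ) * (u a : ℂ) +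
        (((y a : ℂ) - (x a : ℂ)) - (x a : ℂ) * ϱ) * (v a : ℂ)) =
      ∑ t, ((lre t : ℂ) + (lim t : ℂ) * ϱ) * (w t : ℂ) := by
  have e1 := congrArg (fun q : ℚ => (q : ℂ)) hre
  have e2 := congrArg (fun q : ℚ => (q : ℂ)) him
  push_cast at e1 e2
  have eL : ∑ a, (((x a : ℂ) + (y a : ℂ) * ϱ) * (u a : ℂ) +
      (((y a : ℂ) - (x a : ℂ)) - (x a : ℂ) * ϱ) * (v a : ℂ)) =
      ∑ a, ((x a : ℂ) * (u a : ℂ) + ((y a : ℂ) - (x a : ℂ)) * (v a : ℂ)) +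
        ϱ * ∑ a, ((y a : ℂ) * (u a : ℂ) - (x a : ℂ) * (v a : ℂ)) := by
    rw [Finset.mul_sum, ← Finset.sum_add_distrib]
    exact Finset.sum_congr rfl fun a _ => by ring
  have eR : ∑ t, ((lre t : ℂ) + (lim t : ℂ) * ϱ) * (w t : ℂ) =
      ∑ t, (lre t : ℂ) * (w t : ℂ) + ϱ * ∑ t, (lim t : ℂ) * (w t : ℂ) := by
    rw [Finset.mul_sum, ← Finset.sum_add_distrib]
    exact Finset.sum_congr rfl fun t _ => by ring
  rw [eL, eR]
  linear_combination e1 + ϱ * e2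

/-- **Row numbers over `ℚ(ρ)`** (`γ = ρ⁻¹ = ρ²`): cf. `unit_rows_numbers`. [folklore] -/
theorem eisen_rows_numbers {r R T : ℕ} (xv : Fin r → ℂ) (X : Fin R → ℂ)
    (p q : Fin R → Fin r → ℤ)
    (hX : ∀ a, X a = ∑ j, ((p a j : ℂ) * xv j + (q a j : ℂ) * (ϱ ^ 2 * xv j)))
    (x y : Fin R → ℚ) (n : Fin T → Fin r → ℤ) (kt : Fin T → ℂ)
    (hrows : ∀ t, ∑ j, (n t j : ℂ) * xv j + kt t = 0) (lre lim : Fin T → ℚ)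
    (hre : ∀ j, ∑ a, (x a * p a j + (y a - x a) * q a j) = ∑ t, lre t * n t j)
    (him : ∀ j, ∑ a, (y a * p a j - x a * q a j) = ∑ t, lim t * n t j)
    {k : ℂ} (hk : ∑ t, ((lre t : ℂ) + (lim t : ℂ) * ϱ) * kt t = k) :
    ∑ a, ((x a : ℂ) + (y a : ℂ) * ϱ) * X a + k = 0 :=
  unit_rows_numbers xv X (ϱ ^ 2) p q hX _ (fun a => ((y a : ℂ) - (x a : ℂ)) - (x a : ℂ) * ϱ)
    (fun a => by linear_combination ((y a : ℂ) - (x a : ℂ)) * ρ_sq' + (-(y a : ℂ)) * ϱ * ρ_sq')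
    n kt hrows _
    (fun j => eisen_coef_split' x y (fun a => p a j) (fun a => q a j) lre lim (fun t => n t j)
      (hre j) (him j)) hk

include h₂ h₃ in
/-- **`ℚ(ρ)`-rows, form `ω = dx/(2y)`** on a curve with `ρΛ = Λ`: the row
`Σ_a (x_a + y_a ρ)·Sω[D_a]` (symbols at rational points, their `[ρ]`-images, `Ω₁`, `ρΩ₁`) lies in
`⟨(R1)–(R5)⟩_ℚ̄`, given integer relations `n_t` among the base logarithms and the exact
`ℚ`-identities `hre`, `him` of coefficient vectors (the `1`- and `ρ`-components of
`Σ_a c_a (p_a + ρ q_a) = Σ_t λ_t n_t`).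
[cite: HuberWustholz2022, §13.1 (A)–(B) p.120, Thm 13.3 (2) p.121, §18.1 pp.160–161] -/
theorem span_eisen_rows_omega (hU : ∀ x, ϱ * x ∈ L.lattice ↔ x ∈ L.lattice)
    {r : ℕ} (m : Fin r → ℂ) (hm : ∀ j, AlgLog L (m j))
    {R : ℕ} (M : Fin R → ℂ) (p q : Fin R → Fin r → ℤ)
    (hM : ∀ a, M a = ∑ j, ((p a j : ℂ) * m j + (q a j : ℂ) * (ϱ * m j)))
    (x y : Fin R → ℚ) {T : ℕ} (n : Fin T → Fin r → ℤ) (hn : ∀ t, ∑ j, (n t j : ℂ) * m j = 0)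
    (lre lim : Fin T → ℚ)
    (hre : ∀ j, ∑ a, (x a * p a j - y a * q a j) = ∑ t, lre t * n t j)
    (him : ∀ j, ∑ a, (y a * p a j + (x a - y a) * q a j) = ∑ t, lim t * n t j)
    {t₀ : ℂ} (ht₀ : IsAlgPt L t₀) (D : ∀ a, LiftData L t₀ (t₀ + M a)) :
    InSpanRel (∑ a, ((x a : ℂ) + (y a : ℂ) * ϱ) • Sω[D a]) :=
  span_unit_rows_omega h₂ h₃ PeriodPair.ρ_ne_zero hU m hm M p q hM _
    (fun a => -(y a : ℂ) + ((x a : ℂ) - (y a : ℂ)) * ϱ)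
    (fun a => isAlgebraic_eisen (x a) (y a))
    (fun a => by linear_combination (-(y a : ℂ)) * ρ_sq') n hn
    (fun t => (lre t : ℂ) + (lim t : ℂ) * ϱ) (fun t => isAlgebraic_eisen (lre t) (lim t))
    (fun j => eisen_coef_split x y (fun a => p a j) (fun a => q a j) lre lim (fun t => n t j)
      (hre j) (him j)) ht₀ D

include h₂ h₃ in
/-- **`ℚ(ρ)`-rows, form `η = x dx/(2y)`** (`β = ρ⁻¹ = ρ²`), with the explicit constants `e_a`, `k`
as in `span_unit_rows_eta`. [cite: HuberWustholz2022, §13.1 (A)–(B) p.120, Thm 13.3 (2) p.121,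
§18.1 pp.160–161] -/
theorem span_eisen_rows_eta (hU : ∀ x, ϱ * x ∈ L.lattice ↔ x ∈ L.lattice)
    {r : ℕ} (m : Fin r → ℂ) (hm : ∀ j, AlgLog L (m j))
    {R : ℕ} (M : Fin R → ℂ) (p q : Fin R → Fin r → ℤ)
    (hM : ∀ a, M a = ∑ j, ((p a j : ℂ) * m j + (q a j : ℂ) * (ϱ * m j)))
    (x y : Fin R → ℚ) {T : ℕ} (n : Fin T → Fin r → ℤ) (hn : ∀ t, ∑ j, (n t j : ℂ) * m j = 0)
    (lre lim : Fin T → ℚ)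
    (hre : ∀ j, ∑ a, (x a * p a j + (y a - x a) * q a j) = ∑ t, lre t * n t j)
    (him : ∀ j, ∑ a, (y a * p a j - x a * q a j) = ∑ t, lim t * n t j)
    {t₀ : ℂ} (ht₀ : IsAlgPt L t₀) (D : ∀ a, LiftData L t₀ (t₀ + M a)) (e z : Fin R → ℂ)
    (hz : ∀ a, L.weierstrassZeta (t₀ + M a) - L.weierstrassZeta t₀ = z a + e a)
    (k : ℂ) (hrow : ∑ a, ((x a : ℂ) + (y a : ℂ) * ϱ) * z a + k = 0) :
    InSpanRel (∑ a, ((x a : ℂ) + (y a : ℂ) * ϱ) • (Sη[D a] + e a • 𝟙) - k • 𝟙) :=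
  span_unit_rows_eta h₂ h₃ PeriodPair.ρ_ne_zero hU m hm M p q hM _
    (fun a => ((y a : ℂ) - (x a : ℂ)) - (x a : ℂ) * ϱ)
    (fun a => isAlgebraic_eisen (x a) (y a))
    (fun a => by
      rw [ρ_inv]; linear_combination ((y a : ℂ) - (x a : ℂ)) * ρ_sq' + (-(y a : ℂ)) * ϱ * ρ_sq')
    n hn
    (fun t => (lre t : ℂ) + (lim t : ℂ) * ϱ) (fun t => isAlgebraic_eisen (lre t) (lim t))
    (fun j => eisen_coef_split' x y (fun a => p a j) (fun a => q a j) lre lim (fun t => n t j)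
      (hre j) (him j)) ht₀ D e z hz k hrow

/-- **The base-point dictionary at an image point**: `ζ(t₀ + ρu) − ζ(t₀) = ρ²ζ(u) + e` with the
base-point constant of the image point `[ρ]φ(u) = (ρx, y)`.
[cite: ArmitageEberlein2001, §7.4.2 (7.66)] -/
theorem zeta_base_point_ρ (hU : ∀ x, ϱ * x ∈ L.lattice ↔ x ∈ L.lattice) {t₀ u x y : ℂ}
    (ht : t₀ ∉ L.lattice) (hu : u ∉ L.lattice) (hX : phi L u = ![x, y])
    (hne : ℘[L] t₀ ≠ ϱ * x) : L.weierstrassZeta (t₀ + ϱ * u) - L.weierstrassZeta t₀ =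
      ϱ ^ 2 * L.weierstrassZeta u + (℘'[L] t₀ / 2 - y) / (℘[L] t₀ - ϱ * x) := by
  rw [← weierstrassZeta_ρ_mul hU]
  exact zeta_base_point ht ((unit_mul_notMem_iff hU).2 hu) (phi_ρ_mul hU hX) hne

end Summit.KontsevichZagierPeriods.KzOnePeriods.E1LiftDerivation

end
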